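import Summits.Ventures.Crystal3D.Theorems.StickyWulffConstantCoaxialWallLawSeamUnionCore
import HarnessLib

/-!
# ONE NAMED INPUT FOR BOTH T5b STUBS: `UnionCoreCap s` (a certificate on the union core) ⇒ `SeamResidual s k₀`, `CoherentSeamSmall s k₀`, `IncoherentSeamSmall s k₀`
# (crux `CoaxialWallLaw`, stmt-Ventures-19481; line `WallLedgerF`, skeleton 'CoaxialWallLawCertificates' v8.1, stubs `stub_coherentSeamSmall`, `stub_incoherentSeamSmall`)

HONEST FRAMING. Venture `Summits/Ventures/Crystal3D` (cell `crystal3d-full`); the by-name path of the multi-piece architecture (F-TAIL-g12 §7–§9) for the crux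
`CoaxialWallLaw` (stmt-Ventures-19481, `route-Ventures-StickyWulffConstant`), lane F T5b.  The input `UnionCoreCap s` is NAMED, NOT PROVED; nothing about the stubs is
claimed as settled; F-C1 not moved.
* `UnionCoreCap s` — CERTIFICATE-SHAPED input: for every frame `L`, every `1`-separated `Y`, every payer `z ∈ Y` of degree `≤ 11`, the UNION CORE `unionCore Y z v2 (S₁ L) (S₂ L)`
  ('…SeamUnionCore': the capping closure, inside `B̄(z,3)`, of all exact pieces carrying an (A)-pair ending within `1` of `z`) has positive capped pools
  (`capPool capTable₂`) at its loaded balls within `1` of `z` and capped joint summand `capSummand capTable₂ ≤ s`.  The union core is a cap-closed union of exact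
  (coherent) clusters; its pools are eroded by at most the junk cap table (`junkCapBoundClosed_capTable₂`, proved);
* **`localSummandA_le_of_unionCoreCap`** — `UnionCoreCap s ⇒ Σ_A(Y, z) ≤ s` at EVERY payer of degree `≤ 11` (no residual hypotheses used);
* **`seamResidual_of_unionCoreCap`**, **`coherentSeamSmall_of_unionCoreCap`**, **`incoherentSeamSmall_of_unionCoreCap`** — hence both registered T5b stubs of
  'Certificates' v8.1 (`stub_coherentSeamSmall : CoherentSeamSmall (2√6) 3`, `stub_incoherentSeamSmall : IncoherentSeamSmall (2√6) 3`) close BY NAME from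
  `UnionCoreCap (2 * Real.sqrt 6)` — one certificate instead of {CoherentSeamSmall, CoherentCoreCap, SeamSparsity}.
WHAT THIS IS NOT: `UnionCoreCap` is open (cf-p2-style enumeration of union cores around a payer + the crowding of foreign clusters, F-TAIL-g12 §8 (C1)/(C2)).
-/

noncomputable section

namespace Summit.Ventures.Crystal3D.Theorems

namespace TailResidue

open Summit.Ventures.Crystal3D Finset
open scoped InnerProductSpace

open scoped Classical in
/-- **UNION-CORE CERTIFICATE at the line `s` (named input)**: at every payer `z ∈ Y` of degree `≤ 11` of a `1`-separated configuration, for every frame `L`, the union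
core of `z` has positive capped pools at its loaded balls within `1` of `z` and capped joint (A)-summand `≤ s` (cap table `capTable₂`, systems `v2`, basal systems of
`L` and of its half-turn). -/
def UnionCoreCap (s : ℝ) : Prop :=
  ∀ L : EuclideanSpace ℝ (Fin 3) ≃ₗᵢ[ℝ] EuclideanSpace ℝ (Fin 3),
  ∀ Y : Finset (EuclideanSpace ℝ (Fin 3)), (∀ p ∈ Y, ∀ q ∈ Y, p ≠ q → 1 ≤ dist p q) →
  ∀ z ∈ Y, (Y.filter fun q => dist z q = 1).card ≤ 11 →
    (∀ b ∈ unionCore Y z WordVersion.v2 (basalSystem L) (basalSystem (((ℝ ∙ EuclideanSpace.single (2 : Fin 3) (1 : ℝ)).reflection).trans L)),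
      dist z b ≤ 1 →
      0 < endMultA (unionCore Y z WordVersion.v2 (basalSystem L) (basalSystem (((ℝ ∙ EuclideanSpace.single (2 : Fin 3) (1 : ℝ)).reflection).trans L)))
        WordVersion.v2 (basalSystem L) (basalSystem (((ℝ ∙ EuclideanSpace.single (2 : Fin 3) (1 : ℝ)).reflection).trans L)) b →
      0 < capPool capTable₂ (unionCore Y z WordVersion.v2 (basalSystem L) (basalSystem (((ℝ ∙ EuclideanSpace.single (2 : Fin 3) (1 : ℝ)).reflection).trans L))) b) ∧
    capSummand capTable₂ WordVersion.v2 (basalSystem L) (basalSystem (((ℝ ∙ EuclideanSpace.single (2 : Fin 3) (1 : ℝ)).reflection).trans L))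
      (unionCore Y z WordVersion.v2 (basalSystem L) (basalSystem (((ℝ ∙ EuclideanSpace.single (2 : Fin 3) (1 : ℝ)).reflection).trans L))) z ≤ s

/-- Monotonicity in the line. -/
theorem unionCoreCap_mono {s s' : ℝ} (h : UnionCoreCap s) (hs : s ≤ s') : UnionCoreCap s' := fun L Y hY z hz hdeg =>
  ⟨(h L Y hY z hz hdeg).1, (h L Y hY z hz hdeg).2.trans hs⟩

open scoped Classical in
/-- **`UnionCoreCap s ⇒ Σ_A(Y, z) ≤ s`** at every payer of degree `≤ 11` (the multi-piece assembly '…SeamUnionCore' + the proved table `junkCapBoundClosed_capTable₂`). -/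
theorem localSummandA_le_of_unionCoreCap {s : ℝ} (h : UnionCoreCap s) (L : EuclideanSpace ℝ (Fin 3) ≃ₗᵢ[ℝ] EuclideanSpace ℝ (Fin 3))
    {Y : Finset (EuclideanSpace ℝ (Fin 3))} (hY : ∀ p ∈ Y, ∀ q ∈ Y, p ≠ q → 1 ≤ dist p q) {z : EuclideanSpace ℝ (Fin 3)} (hz : z ∈ Y)
    (hdeg : (Y.filter fun q => dist z q = 1).card ≤ 11) :
    localSummandA WordVersion.v2 (basalSystem L) (basalSystem (((ℝ ∙ EuclideanSpace.single (2 : Fin 3) (1 : ℝ)).reflection).trans L)) Y z ≤ s := by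
  obtain ⟨hpos, hsum⟩ := h L Y hY z hz hdeg
  have h₁ : (basalSystem L).RT ⊆ fccSlots := filter_subset _ _
  have h₂ : (basalSystem (((ℝ ∙ EuclideanSpace.single (2 : Fin 3) (1 : ℝ)).reflection).trans L)).RT ⊆ fccSlots := filter_subset _ _
  exact (localSummandA_le_capSummand_unionCore capTable₂ hY h₁ h₂ junkCapBoundClosed_capTable₂ hpos).trans hsum

/-- **`UnionCoreCap s ⇒ SeamResidual s k₀`** (any `k₀`; no deletion, no residual hypothesis used). -/
theorem seamResidual_of_unionCoreCap {s : ℝ} {k₀ : ℕ} (h : UnionCoreCap s) : SeamResidual s k₀ :=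
  fun L _ hY _ hz hdeg _ _ _ _ => Or.inr (localSummandA_le_of_unionCoreCap h L hY hz hdeg)

/-- **`UnionCoreCap s ⇒ CoherentSeamSmall s k₀`** (the cf-p2 stub of v8.1 follows too). -/
theorem coherentSeamSmall_of_unionCoreCap {s : ℝ} {k₀ : ℕ} (h : UnionCoreCap s) : CoherentSeamSmall s k₀ :=
  fun L _ hY _ hz hdeg _ _ _ _ _ => Or.inr (localSummandA_le_of_unionCoreCap h L hY hz hdeg)

/-- **`UnionCoreCap s ⇒ IncoherentSeamSmall s k₀`** (this lane's stub of v8.1). -/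
theorem incoherentSeamSmall_of_unionCoreCap {s : ℝ} {k₀ : ℕ} (h : UnionCoreCap s) : IncoherentSeamSmall s k₀ :=
  fun L _ hY _ hz hdeg _ _ _ _ _ => Or.inr (localSummandA_le_of_unionCoreCap h L hY hz hdeg)

/-- The shape lane F's by-name closers take: `UnionCoreCap (2√6)` closes both T5b stubs at `k₀ = 3`. -/
theorem t5b_of_unionCoreCap (h : UnionCoreCap (2 * Real.sqrt 6)) : CoherentSeamSmall (2 * Real.sqrt 6) 3 ∧ IncoherentSeamSmall (2 * Real.sqrt 6) 3 :=
  ⟨coherentSeamSmall_of_unionCoreCap h, incoherentSeamSmall_of_unionCoreCap h⟩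

end TailResidue

end Summit.Ventures.Crystal3D.Theorems

end
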